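/-
Copyright (c) 2026 the pub-hodgecm-mathlib formalisation cell (harness21).  Prover seat hodgecm-mathlib-R90-C14-p01 (g0), HCML SLAB R90-TF,
section S6 «Ch. 14.1–14.5 stable trace formula» (base `R90-C14`), S6 WAVE 5 DEAL (R90-C14-plan (g0), R90 bus 2026-09-04T22:05:19Z), cards W5-b + W5-b′.
2026-09-04.
-/
import Literature.NumberTheory.Automorphic.HyperspecialUnitarySatakeTransformAdicCompletion   -- ★ `unitaryHeckeEigencharacterAdic`, `unitarySatakeTransformAdic`
import Literature.NumberTheory.Automorphic.HyperspecialUnitarySatakeIsomorphismAdicCompletion  -- ★ adic Satake isomorphism estate (sheet import)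
import Literature.NumberTheory.Automorphic.UnitaryRankOneUnramifiedCharacters                  -- ★ `exists_units_add_inv_eq` (`z + z⁻¹ = t` is solvable in `ℂˣ`)
import Summits.HodgeConjecture.HodgeConjecture.Theorems.R90S6HeckeEigenpolyThreeExists         -- ★ p862233 (W3-c): `unitaryHeckeEigencharacterAdic_three_aeval`, `exists_generator_unitaryHeckeAlgebraAdic_three`
import HarnessLib

/-!
# R90 · S6 «Ch. 14.1–14.5 stable trace formula» — WAVE 5 cards W5-b + W5-b′: `ℋ(U(J₀,3)(E_w), K₀)` IS SEPARATED BY ITS UNRAMIFIED EIGENCHARACTERS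
# (`Theorems/R90S6HeckeSeparatedByEigencharacterThree.lean`: `λ_{(z,1,1)}(φ) = λ_{(z,1,1)}(φ′)` for all `z ∈ ℂˣ` ⇒ `φ = φ′`; the same with `z ↦ −z`)

Cell `hodgecm-mathlib`, crux H413 (`stmt-HodgeConjecture-24833`), route of record `HCCMUnconditional`; programme R90-TF, section S6 (base `R90-C14`),
seat R90-C14-p01 (g0); S6 WAVE 5 DEAL (R90-C14-plan (g0), R90 bus 22:05:19Z), cards W5-b (:39–:45) + W5-b′ (:47–:53) of the sheet
`R90/R90-C14-plan/g0/S6_wave5_targets.v1.R90-C14-plan-g0.lean` 9b668b58b52808d7 (signatures token-identical, namespace segment `.Wave5` dropped).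
Helper lane `--supports stmt-HodgeConjecture-24833 --as helper`; THEOREMS ONLY (no definition, no instance, no notation, no named fact, no `sorry`);
imports = ★ Literature Satake files + ★ `Theorems.R90S6HeckeEigenpolyThreeExists` (W3-c) + HarnessLib (no Lines import).

THE PRINT [Rogawski1990, §4.5 p. 50 (unramified `σ_w` ↔ `W`-class of unramified characters of `T`), §4.9 Prop. 4.9.1 p. 55 (`ξ̂_H(f)^∧(z) = f^∧(−z)`,
the map `f ↦ ξ̂_H(f)`)]; [CartierCorvallis1979, §IV Thm. 4.1, Cor. 4.2] (`ℋ(G, K) ≅ ℂ[Λ]^W`; the characters of `ℋ` are the `f ↦ 𝒮f(χ)` and they separate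
`ℋ`).  For `U(J₀, 3)(E_w)` at an inert unramified `w` the spherical Hecke algebra is `ℂ[T₁]` with `𝒮_w(T₁) = x^{(1,0,-1)} + x^{(-1,0,1)}`
(★ `exists_generator_unitaryHeckeAlgebraAdic_three`, W3-c p862233) and `λ_{(z,1,1)}(P(T₁)) = P(z + z⁻¹)` (★ `unitaryHeckeEigencharacterAdic_three_aeval`);
`z ↦ z + z⁻¹` is onto `ℂ` (★ `exists_units_add_inv_eq`), so two polynomials agreeing at every `z + z⁻¹` agree everywhere (Mathlib `Polynomial.funext`).
This is the `U(3)` twin of R90-C14-p03's `U(2)` road ★ `satakeGraph_partner_unique` (p862296), mirrored line by line.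
* **`hecke_eq_of_eigencharacter_three_eq`** — W5-b: `(∀ z, λ_{(z,1,1)}(φ) = λ_{(z,1,1)}(φ′)) → φ = φ′`.
* **`hecke_eq_of_partner_eigencharacter_eq`** — W5-b′: the same with the PARTNER parameters `(−z, 1, 1)` (W5-b at `z ↦ −z`): equal partners ⇒ equal
  operators, i.e. the Satake-graph partner map `φ ↦ φ^H` of FILE D § (E1-c) is injective on the `U(3)` side.
HONEST LABEL: supply lemma for FILE D § (E1-c) ∕ S6 ED. 2b Hecke separation; pays no socket by itself; local spherical Hecke algebra bookkeeping,
proves no printed global statement.  HC_CM is proved only modulo the 7 printed citations (2 remaining named inputs: hLiu418 = stmt-HodgeConjecture-24832,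
h413 = stmt-HodgeConjecture-24833) until rung 0 closes; count-neutral helper.

## Tree search
★ `unitaryHeckeEigencharacterAdic_three_aeval`, `exists_generator_unitaryHeckeAlgebraAdic_three` (p862233), ★ `exists_units_add_inv_eq`
(`UnitaryRankOneUnramifiedCharacters` :233), ★ `satakeGraph_partner_unique` (p862296, the `N = 2` twin), ★ `hecke_eigencharacters_separate_three` (p862265,
the DUAL statement: eigencharacters with distinct traces are linearly independent — not this card); Mathlib `Polynomial.funext`, `neg_neg`.  Dedup:
`rg "hecke_eq_of_eigencharacter_three_eq|hecke_eq_of_partner_eigencharacter_eq"` over `lean/` — only the sheet's `sorry` (R90/, not in tree).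

## References
* [Rogawski1990] J. D. Rogawski, *Automorphic Representations of Unitary Groups in Three Variables*, Ann. of Math. Stud. 123 (1990), §4.5 p. 50; §4.9 Prop. 4.9.1 p. 55.
* [CartierCorvallis1979] P. Cartier, *Representations of 𝔭-adic groups: a survey*, PSPM 33.1 (1979), §IV (4.2)–(4.4), Thm. 4.1, Cor. 4.2.
* [Minguez2011] A. Mínguez, *Unramified representations of unitary groups* (2011), §4.
* [Satake1963] I. Satake, *Theory of spherical functions on reductive algebraic groups over 𝔭-adic fields*, Publ. Math. IHÉS 18 (1963), §§6–7.
-/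

set_option autoImplicit false
-- the mandated namespace repeats the single-problem summit's segment (`HodgeConjecture.HodgeConjecture`)
set_option linter.dupNamespace false

noncomputable section

open NumberField IsDedekindDomain Polynomial
open Literature.NumberTheory.Automorphic Literature.NumberTheory.Automorphic.HermitianLattice Literature.NumberTheory.Automorphic.UnitaryGroup

namespace Summit.HodgeConjecture.HodgeConjecture.R90.S6

variable {F E : Type} [Field F] [NumberField F] [Field E] [NumberField E] [Algebra F E] [Algebra.IsQuadraticExtension F E]
  (c : E ≃ₐ[F] E) (hc1 : c ≠ 1) (v : HeightOneSpectrum (𝓞 F)) (w : PlacesOver E v) (hw : c • w.1 = w.1)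
  (hv : Algebra.IsUnramifiedIn (𝓞 E) v.asIdeal)

/-! ## W5-b -/

/-- **W5-b — the unramified eigencharacters separate `ℋ(U(J₀,3)(E_w), K₀)`** [Rogawski1990, §4.5 p. 50, §4.9 Prop. 4.9.1 p. 55; CartierCorvallis1979 §IV
Thm. 4.1, Cor. 4.2]: two elements `φ, φ′` of `ℋ(U(J₀,3)(E_w), K₀)` with the same eigenvalues `λ_{(z,1,1)}(φ) = λ_{(z,1,1)}(φ′)` for ALL `z ∈ ℂˣ` are equal —
write `φ = P(T₁)`, `φ′ = P′(T₁)` (★ `exists_generator_unitaryHeckeAlgebraAdic_three`); then `P(z + z⁻¹) = P′(z + z⁻¹)` for all `z`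
(★ `unitaryHeckeEigencharacterAdic_three_aeval`), `z ↦ z + z⁻¹` is onto `ℂ` (★ `exists_units_add_inv_eq`), so `P = P′` (`Polynomial.funext`).  The `U(3)` twin
of ★ `satakeGraph_partner_unique`.  (Sheet `S6_wave5_targets.v1` :39–:45 token-for-token; supply lemma for FILE D § (E1-c) ∕ S6 ED. 2b Hecke separation;
pays no socket by itself.) [cite: Rogawski1990, §4.5 p. 50; §4.9 Prop. 4.9.1 p. 55] [cite: CartierCorvallis1979, §IV Thm. 4.1, Cor. 4.2] -/
theorem hecke_eq_of_eigencharacter_three_eq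
    (φ φ' : heckeAlgebra ℂ ↥(unitaryGroupOfForm (galAdicCompletionMap (L := E) c hw) ((StdForm.antidiagonal 3).over (w.1.adicCompletion E)))
      (unitaryInt (galAdicCompletionMap (L := E) c hw) ((StdForm.antidiagonal 3).over (w.1.adicCompletion E))))
    (h : ∀ z : ℂˣ, unitaryHeckeEigencharacterAdic c hc1 v w hw hv ![z, 1, 1] φ = unitaryHeckeEigencharacterAdic c hc1 v w hw hv ![z, 1, 1] φ') :
    φ = φ' := by
  obtain ⟨T₁, hT₁, hgen⟩ := exists_generator_unitaryHeckeAlgebraAdic_three c hc1 v w hw hv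
  obtain ⟨P, rfl⟩ := hgen φ
  obtain ⟨P', rfl⟩ := hgen φ'
  have hPP' : P = P' := by
    refine Polynomial.funext fun t => ?_
    obtain ⟨z, hz⟩ := exists_units_add_inv_eq t
    rw [← hz, ← unitaryHeckeEigencharacterAdic_three_aeval c hc1 v w hw hv hT₁ P z,
      ← unitaryHeckeEigencharacterAdic_three_aeval c hc1 v w hw hv hT₁ P' z]
    exact h z
  rw [hPP']

/-! ## W5-b′ -/

/-- **W5-b′ — the Satake-graph partner map is injective on the `U(3)` side** [Rogawski1990, §4.9 Prop. 4.9.1 p. 55 (`ξ̂_H(f)^∧(z) = f^∧(−z)`)]: two elements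
`φ, φ′` of `ℋ(U(J₀,3)(E_w), K₀)` with the same PARTNER eigenvalues `λ_{(−z,1,1)}(φ) = λ_{(−z,1,1)}(φ′)` for ALL `z ∈ ℂˣ` are equal (W5-b at `z ↦ −z`,
`−(−z) = z`).  (Sheet `S6_wave5_targets.v1` :47–:53 token-for-token; corollary for the W4 `satakeGraphPartnerAlgHom` ∕ (E1-c) consumers; pays no socket by itself.)
[cite: Rogawski1990, §4.9 Prop. 4.9.1 p. 55] [cite: CartierCorvallis1979, §IV Cor. 4.2] -/
theorem hecke_eq_of_partner_eigencharacter_eq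
    (φ φ' : heckeAlgebra ℂ ↥(unitaryGroupOfForm (galAdicCompletionMap (L := E) c hw) ((StdForm.antidiagonal 3).over (w.1.adicCompletion E)))
      (unitaryInt (galAdicCompletionMap (L := E) c hw) ((StdForm.antidiagonal 3).over (w.1.adicCompletion E))))
    (h : ∀ z : ℂˣ, unitaryHeckeEigencharacterAdic c hc1 v w hw hv ![-z, 1, 1] φ = unitaryHeckeEigencharacterAdic c hc1 v w hw hv ![-z, 1, 1] φ') :
    φ = φ' :=
  hecke_eq_of_eigencharacter_three_eq c hc1 v w hw hv φ φ' fun z => by simpa only [neg_neg] using h (-z)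

end Summit.HodgeConjecture.HodgeConjecture.R90.S6

end
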